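import Literature.Computability.Complexity.BFNWGenerator
import Literature.Computability.Complexity.BFNWHardFunction
import Literature.Computability.Complexity.IKWGeneratorsProofs
import Literature.Computability.Complexity.CircuitClassesUniformProofs
import HarnessLib

/-!
# IW98, Case 1 (`EXP ⊄ P/poly`, Babai–Fortnow–Nisan–Wigderson 1993) PROVED: the i.o. generator
# `IWUniform.IOPRGAt`, `BPP ⊆ io-DTIME(2^{n^ε})`, and `impagliazzoWigderson1998` reduced to its Case 2

Literature / complexity — derandomization. This file discharges hypothesis `h₁` of
`impagliazzoWigderson1998_of_generators` (`UniformDerandomizationAssembly.lean`), i.e. the first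
paragraph of §2.1 of Impagliazzo–Wigderson's printed proof ("since [BFNW93] show that
`BPP ⊆ i.o.−SUBEXP` assuming `EXP ⊄ P/poly`, we can assume `EXP ⊂ P/poly`"), by assembling

* the hard function (`exists_frequently_hard_of_not_EXP_subset_PPoly`, `BFNWHardFunction.lean`):
  `f₀ ∈ EXP` whose circuit complexity beats every polynomial infinitely often;
* the generator of IKW's Theorem 11 (`IKW2002_thm11_tableGenerator`, `IKWGeneratorsProofs.lean`), run on
  the truth table of `f₀ ∩ {0,1}^m` at the scale `m = Nat.sqrt^[j] n`, as a `2^{O(m^p)} · poly(n)`-time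
  machine with its matrix clause (`IWUniform.matrix_clause_tableGen`, `BFNWGenerator.lean`,
  `BFNWTable.lean`);
* the fooling step at one length (`IWUniform.abs_vote_sub_truth_le_of_isSizePseudorandom`,
  `BFNWFooling.lean`) with the test circuits of `P ⊆ P/poly` (`exists_cktSize_boolPair_of_mem_PPoly`,
  `P_subset_PPoly_holds`);
* the good lengths: `n` with `m(n)` hard above the threshold `(Nb(n) + m)^c ≤ m^d`
  (`exists_pow_le_iterate_sqrt_pow`, `frequently_comp_of_monotone_surjective`, `IKWScales.lean`).

Results:

* **`IWUniform.ioPRGAt_of_not_EXP_subset_PPoly`** — `EXP ⊄ P/poly ⟹ ∀ ε > 0, ∀ L' ∈ P, ∀ q, IOPRGAt ε L' q`;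
* **`BPP_subset_io_DTIME_of_not_EXP_subset_PPoly`** — Babai–Fortnow–Nisan–Wigderson's theorem
  `EXP ⊄ P/poly ⟹ BPP ⊆ io-DTIME(2^{n^ε})` for every `ε > 0` (van Melkebeek 2000, Thm. 2.3.7 in the
  i.o. form used by IW; Arora–Barak Thm. 20.7 (3), i.o. version);
* **`impagliazzoWigderson1998_of_uniformPRGAt`** (and `…_samplable_of_uniformPRGAt`) — the named fact
  now follows from its Case 2 ALONE: under `EXP ⊆ P/poly` and `BPP ≠ EXP`, a uniformly pseudorandom
  generator at every scale (`IWUniform.UniformPRGAt`, IW98 §2.2–2.4).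

Everything is proved; no definitions, no named facts.

## References

* [ImpagliazzoWigderson2001] R. Impagliazzo, A. Wigderson, *Randomness vs time: derandomization under
  a uniform assumption*, JCSS 63 (2001) 672–688, Thm. 5 and §2.1, first paragraph.
* L. Babai, L. Fortnow, N. Nisan, A. Wigderson, *BPP has subexponential time simulations unless
  EXPTIME has publishable proofs*, Comput. Complexity 3 (1993) 307–318, Thm. 1.1 / §4 (cited through
  IW §2.1 and van Melkebeek Thm. 2.3.7; not held).
* [VanMelkebeek2000] D. van Melkebeek, LNCS 1950 (2000), Thm. 2.3.7 (p. 37), Thm. 6.2.1 (p. 142).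
* [AroraBarakCC2009] S. Arora, B. Barak, CUP 2009, Lemma 20.3, Thm. 20.6–20.7 and §20.1 (i.o. remark).
* [ImpagliazzoKabanetsWigderson2002] JCSS 65 (2002), Thm. 11.
-/

noncomputable section

namespace Literature.Computability.Complexity

open _root_.Computability Filter Polynomial MetaComplexity

namespace IWUniform

/-- `m^a ≤ m^b + 1` for `a ≤ b` (the `+ 1` covers `m = 0`, `a = 0`). [folklore] -/
private theorem pow_le_pow_add_one_of_le {m a b : ℕ} (h : a ≤ b) : m ^ a ≤ m ^ b + 1 := by
  rcases Nat.eq_zero_or_pos m with rfl | hm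
  · rcases Nat.eq_zero_or_pos a with rfl | ha
    · simp
    · rw [zero_pow (Nat.pos_iff_ne_zero.1 ha)]; exact Nat.zero_le _
  · exact (Nat.pow_le_pow_right hm h).trans (Nat.le_succ _)

/-- **Babai–Fortnow–Nisan–Wigderson's i.o. generator (Case 1 of IW98) in the form `IOPRGAt`.** Under
`EXP ⊄ P/poly`, for every `ε > 0`, every polynomial-time witness `L'` and every coin polynomial `q`
there is an i.o. pseudorandom generator at scale `ε`: the generator of IKW's Theorem 11 on `c m^{sx}`
seed bits armed with the truth table of `f₀ ∩ {0,1}^m`, `f₀ ∈ EXP` hard above every polynomial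
infinitely often, at the scale `m = Nat.sqrt^[j] n` (`p 2^{-j} < ε`, `p = k₀ + sx` dominating the time
exponent of `f₀` and the seed); its matrices are decidable in time `2^{O(m^p)} poly(n)`
(`matrix_clause_tableGen`) and at the infinitely many `n` whose scale is hard it fools the tests
`r ↦ [⟨x, r⟩ ∈ L']`, `|x| = n`, within `1/Nb(n) ≤ 1/9 < 1/6` (`abs_vote_sub_truth_le_of_isSizePseudorandom`).
[cite: ImpagliazzoWigderson2001, §2.1, first paragraph] [cite: VanMelkebeek2000, Thm. 2.3.7 (p. 37)]
[cite: AroraBarakCC2009, Lemma 20.3 and Thm. 20.7 (proofs)] -/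
theorem ioPRGAt_of_not_EXP_subset_PPoly (h : ¬ EXP ⊆ PPoly) {ε : ℝ} (hε : 0 < ε)
    {L' : Language Bool} (hL' : L' ∈ Classes.P) (q : Polynomial ℕ) : IOPRGAt ε L' q := by
  classical
  -- (a) the hard function, its decider and time exponent
  obtain ⟨f₀, hf₀E, hhard⟩ := exists_frequently_hard_of_not_EXP_subset_PPoly h
  obtain ⟨q₀, hdec⟩ := exists_two_pow_eval_of_mem_EXP hf₀E
  obtain ⟨K₀, k₀, hq₀⟩ := exists_eval_le_mul_pow_add q₀
  -- (b) the table generator of IKW's Theorem 11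
  obtain ⟨F, hF, c, sx, hsx, h11⟩ := IKW2002_thm11_tableGenerator
  -- (c) circuits for the tests `(x, r) ↦ [⟨x, r⟩ ∈ L']`
  obtain ⟨qc, hqc⟩ := exists_cktSize_boolPair_of_mem_PPoly (P_subset_PPoly_holds hL')
  -- the exponent `p` and the root depth `j`
  obtain ⟨j, hjε⟩ := exists_root_depth (k₀ + sx) hε
  have hp1 : 1 ≤ k₀ + sx := by omega
  have hq₀' : ∀ m, q₀.eval m ≤ 2 * K₀ * m ^ (k₀ + sx) + 2 * K₀ := fun m => by
    have h1 := hq₀ m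
    have h2 : K₀ * m ^ k₀ ≤ K₀ * (m ^ (k₀ + sx) + 1) :=
      Nat.mul_le_mul_left K₀ (pow_le_pow_add_one_of_le (Nat.le_add_right _ _))
    rw [Nat.mul_add, Nat.mul_one] at h2
    rw [show 2 * K₀ * m ^ (k₀ + sx) + 2 * K₀ = (K₀ * m ^ (k₀ + sx) + K₀) + (K₀ * m ^ (k₀ + sx) + K₀) by
      ring]
    omega
  -- the output length `Nb n = s(n) + 9`, `s(n)` the size of the test circuits on `n + q(n)` bits
  set Nb : Polynomial ℕ := (2 * X + 2 + q) + qc.comp (2 * X + 2 + q) + 9 with hNb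
  have hNb_eval : ∀ n, Nb.eval n = (2 * n + 2 + q.eval n) + qc.eval (2 * n + 2 + q.eval n) + 9 := by
    intro n; simp [hNb]
  -- the seed length `k n = c m^{sx}`
  have hkK : ∃ K, ∀ n, c * (Nat.sqrt^[j] n) ^ sx ≤ K * (Nat.sqrt^[j] n) ^ (k₀ + sx) + K :=
    ⟨c, fun n => by
      have h2 : c * (Nat.sqrt^[j] n) ^ sx ≤ c * ((Nat.sqrt^[j] n) ^ (k₀ + sx) + 1) :=
        Nat.mul_le_mul_left c (pow_le_pow_add_one_of_le (Nat.le_add_left sx k₀))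
      rw [Nat.mul_add, Nat.mul_one] at h2
      exact h2⟩
  -- the generator, its producer and its matrix clause
  obtain ⟨t, hdecM, ht⟩ := matrix_clause_tableGen hF hdec hp1 hq₀' Nb q hkK hL'
  refine ⟨fun n => tableGen F (f₀.sliceFn (Nat.sqrt^[j] n)) (Nb.eval n) (q.eval n),
    fun n => c * (Nat.sqrt^[j] n) ^ sx, k₀ + sx, j, by exact_mod_cast hjε, fpProducer_seed c sx j, hkK,
    ⟨t, hdecM, ht⟩, ?_⟩
  -- (d) the good lengths: the scale is hard above the threshold of Theorem 11
  obtain ⟨d, hd⟩ := exists_pow_le_iterate_sqrt_pow Nb j c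
  have hio : ∃ᶠ n in atTop, (Nat.sqrt^[j] n) ^ d < f₀.circuitSize (Nat.sqrt^[j] n) :=
    frequently_comp_of_monotone_surjective (monotone_iterate_sqrt j) (surjective_iterate_sqrt j) (hhard d)
  refine (hio.and_eventually hd).mono ?_
  rintro n ⟨hhardn, hthr⟩ x hx
  show |vote L' (tableGen F (f₀.sliceFn (Nat.sqrt^[j] n)) (Nb.eval n) (q.eval n))
      (c * (Nat.sqrt^[j] n) ^ sx) x - truth L' (q.eval n) x| < 1 / 6
  -- (e) fooling at a good length
  have hcs : (Nb.eval n + Nat.sqrt^[j] n) ^ c < circuitSizeOver B2 (f₀.sliceFn (Nat.sqrt^[j] n)) :=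
    hthr.trans_lt hhardn
  have hps := h11 (Nat.sqrt^[j] n) (Nb.eval n) (f₀.sliceFn (Nat.sqrt^[j] n)) hcs
  have hmN : q.eval n ≤ Nb.eval n := by rw [hNb_eval]; omega
  have hsN : (2 * n + 2 + q.eval n) + qc.eval (2 * n + 2 + q.eval n) + 2 ≤ Nb.eval n := by
    rw [hNb_eval]; omega
  have habs := abs_vote_sub_truth_le_of_isSizePseudorandom (hqc n (q.eval n)) F
    (f₀.sliceFn (Nat.sqrt^[j] n)) hps hmN hsN x hx
  exact habs.trans_lt (one_div_lt_one_sixth (by rw [hNb_eval]; omega))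

end IWUniform

/-- **Babai–Fortnow–Nisan–Wigderson 1993 (the "low end" of hardness versus randomness), i.o. form**:
`EXP ⊄ P/poly ⟹ BPP ⊆ io-DTIME(2^{n^ε})` for every `ε > 0` — the first paragraph of IW98's §2.1
("since [BFNW93] show that `BPP ⊆ i.o.−SUBEXP` assuming `EXP ⊄ P/poly` …"), proved: the i.o.
generator of `IWUniform.ioPRGAt_of_not_EXP_subset_PPoly` under the majority-vote simulation
(`impagliazzoWigderson1998_case1_of_ioPRG`). [cite: ImpagliazzoWigderson2001, §2.1, first paragraph]
[cite: VanMelkebeek2000, Thm. 2.3.7 (p. 37)] [cite: AroraBarakCC2009, Thm. 20.7 and §20.1] -/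
theorem BPP_subset_io_DTIME_of_not_EXP_subset_PPoly (h : ¬ EXP ⊆ PPoly) {ε : ℝ} (hε : 0 < ε) :
    BPP ⊆ io (DTIME fun n => 2 ^ ⌈(n : ℝ) ^ ε⌉₊) :=
  impagliazzoWigderson1998_case1_of_ioPRG
    (fun h' _ hε' _ hL' q => IWUniform.ioPRGAt_of_not_EXP_subset_PPoly h' hε' hL' q) h ε hε

/-- **`impagliazzoWigderson1998` from its Case 2 alone.** With Case 1 (`EXP ⊄ P/poly`, BFNW) proved,
the named fact follows from the uniformly pseudorandom generators of IW98 §2.2–2.4 under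
`EXP ⊆ P/poly` and `BPP ≠ EXP` (`IWUniform.UniformPRGAt` at every scale and output polynomial) —
the remaining obligation of the discharge. [cite: ImpagliazzoWigderson2001, Thm. 5 and §2.1]
[cite: VanMelkebeek2000, Thm. 6.2.1 (p. 142)] -/
theorem impagliazzoWigderson1998_of_uniformPRGAt
    (h₂ : EXP ⊆ PPoly → BPP ≠ EXP → ∀ ε : ℝ, 0 < ε → ∀ q : Polynomial ℕ, IWUniform.UniformPRGAt ε q) :
    impagliazzoWigderson1998 :=
  impagliazzoWigderson1998_of_generators
    (fun h _ hε _ hL' q => IWUniform.ioPRGAt_of_not_EXP_subset_PPoly h hε hL' q) h₂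

/-- The same reduction for the tree's rendering `impagliazzoWigderson1998_samplable`
(`UniformDerandomization.lean`). [cite: VanMelkebeek2000, Thm. 6.2.1 (p. 142)] -/
theorem impagliazzoWigderson1998_samplable_of_uniformPRGAt
    (h₂ : EXP ⊆ PPoly → BPP ≠ EXP → ∀ ε : ℝ, 0 < ε → ∀ q : Polynomial ℕ, IWUniform.UniformPRGAt ε q) :
    impagliazzoWigderson1998_samplable :=
  impagliazzoWigderson1998_samplable_of_generators
    (fun h _ hε _ hL' q => IWUniform.ioPRGAt_of_not_EXP_subset_PPoly h hε hL' q) h₂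

end Literature.Computability.Complexity

end
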